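import Literature.Analysis.FunctionSpaces.AubinLionsExtraction
import Mathlib.Algebra.Order.ToIntervalMod
import HarnessLib

/-!
# Moduli of continuity for the equicontinuity hypothesis of the Aubin–Lions extraction

Analysis/FunctionSpaces theorem file (no definitions, no named facts); a small sequel of
`AubinLionsExtraction`, whose extraction theorem
`AubinLions.exists_subseq_strong_limit_of_equicontinuous` consumes, for every test function, one
modulus `ω` with `ω(δ) → 0` (`δ → 0`) bounding `‖g_k(t) − g_k(s)‖ ≤ ω(t − s)` for **all** members
`k` of the sequence. In the Galerkin method (Temam, *Navier–Stokes equations*, Ch. III §3; Hopf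
1951 §4) such a bound is available with explicit constants only for `k ≥ m` (the test field
must lie in the `m`-th Galerkin space, up to an error `ε_m → 0`), while the finitely many
`k < m` are smooth periodic functions of time, each uniformly continuous with its own modulus.
This file supplies the two elementary tools that turn this into one modulus:

* `AubinLions.exists_modulus_of_continuous_periodic` — a continuous `T`-periodic function
  `f : ℝ → F` has a modulus of continuity on the whole line: `‖f t − f s‖ ≤ ω(t − s)` with
  `ω ≥ 0`, `ω(δ) → 0` (uniform continuity on `[−T, 2T]` and periodicity);
* `AubinLions.exists_modulus_finset_sup` — finitely many such functions have a common modulus;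
* `AubinLions.tendsto_iInf_add_modulus` — if `ε_n → 0`, `ε_n ≥ 0`, and `ω_n ≥ 0` are moduli
  (`ω_n(δ) → 0` for each `n`), then `Ω(δ) = inf_n (ε_n + ω_n(δ))` is again a modulus
  (`Ω ≥ 0`, `Ω(δ) → 0`) lying below every `ε_n + ω_n`.

## Mathlib / tree search

Mathlib: `IsCompact.uniformContinuousOn_of_continuous`, `Metric.uniformContinuousOn_iff`,
`toIcoDiv`/`toIcoMod` (`Mathlib.Algebra.Order.ToIntervalMod`), `Function.Periodic.sub_zsmul_eq`,
`Function.Periodic.isBounded_of_continuous`, `csSup`/`ciInf` API. No ready-made "continuous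
periodic functions are uniformly continuous" (`lean search 'Periodic.uniformContinuous'`: none).

## References

* R. Temam, *Navier–Stokes equations* (1977/79), Ch. III §3 (the Galerkin limit) [Temam1979].
* E. Hopf, Math. Nachr. 4 (1951), §4.
-/

noncomputable section

open Set Function Filter Topology Metric

namespace Literature.Analysis.FunctionSpaces

variable {F : Type*} [NormedAddCommGroup F]

/-- **Continuous periodic functions are uniformly continuous on the line**: for `f : ℝ → F`
continuous and `T`-periodic (`T > 0`) and every `ε > 0` there is `δ > 0` with
`‖f t − f s‖ < ε` whenever `|t − s| < δ` (uniform continuity on the compact interval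
`[−T, 2T]`, to which every pair of points at distance `< T` is translated by a common period
shift). [folklore] -/
theorem AubinLions.exists_forall_norm_sub_lt_of_periodic {f : ℝ → F} {T : ℝ} (hT : 0 < T)
    (hf : Continuous f) (hper : Function.Periodic f T) {ε : ℝ} (hε : 0 < ε) :
    ∃ δ : ℝ, 0 < δ ∧ ∀ t s : ℝ, |t - s| < δ → ‖f t - f s‖ < ε := by
  have hK : IsCompact (Icc (-T) (2 * T)) := isCompact_Icc
  have hU := hK.uniformContinuousOn_of_continuous hf.continuousOn
  rw [Metric.uniformContinuousOn_iff] at hU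
  obtain ⟨δ, hδ, hδU⟩ := hU ε hε
  refine ⟨min δ T, lt_min hδ hT, fun t s hts => ?_⟩
  have hδ' : |t - s| < δ := hts.trans_le (min_le_left _ _)
  have hT' : |t - s| < T := hts.trans_le (min_le_right _ _)
  -- shift `s` into `[0, T)` and `t` by the same number of periods
  set n : ℤ := toIcoDiv hT 0 s with hn
  set s' : ℝ := s - n • T with hs'
  set t' : ℝ := t - n • T with ht'
  have hs'mem : s' ∈ Ico (0 : ℝ) (0 + T) := by
    have h := toIcoMod_mem_Ico hT 0 s
    rwa [toIcoMod, ← hn] at h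
  rw [zero_add] at hs'mem
  have hdiff : t' - s' = t - s := by rw [ht', hs']; ring
  have ht'mem : t' ∈ Icc (-T) (2 * T) := by
    have h1 : |t' - s'| < T := by rw [hdiff]; exact hT'
    rw [abs_lt] at h1
    constructor <;> linarith [hs'mem.1, hs'mem.2]
  have hs'mem' : s' ∈ Icc (-T) (2 * T) := ⟨by linarith [hs'mem.1], by linarith [hs'mem.2]⟩
  have hfs : f s' = f s := by rw [hs']; exact hper.sub_zsmul_eq n
  have hft : f t' = f t := by rw [ht']; exact hper.sub_zsmul_eq n
  have hclose : dist t' s' < δ := by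
    rw [Real.dist_eq, hdiff]; exact hδ'
  have h := hδU t' ht'mem s' hs'mem' hclose
  rwa [dist_eq_norm, hft, hfs] at h

/-- **A modulus of continuity on the line for a continuous periodic function**: there is
`ω : ℝ → ℝ` with `ω ≥ 0`, `ω(δ) → 0` as `δ → 0`, and `‖f t − f s‖ ≤ ω(t − s)` for all `t, s`
(the least modulus `ω(δ) = sup {‖f t − f s‖ : |t − s| ≤ |δ|}`, finite since `f` is bounded).
[folklore] -/
theorem AubinLions.exists_modulus_of_continuous_periodic {f : ℝ → F} {T : ℝ} (hT : 0 < T)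
    (hf : Continuous f) (hper : Function.Periodic f T) :
    ∃ ω : ℝ → ℝ, Tendsto ω (𝓝 0) (𝓝 0) ∧ (∀ δ, 0 ≤ ω δ) ∧ ∀ t s, ‖f t - f s‖ ≤ ω (t - s) := by
  -- `f` is bounded
  obtain ⟨C, hC⟩ : ∃ C : ℝ, ∀ x, ‖f x‖ ≤ C := by
    have hb := (hper.isBounded_of_continuous hT.ne' hf)
    obtain ⟨C, hC⟩ := hb.subset_closedBall (0 : F)
    exact ⟨C, fun x => mem_closedBall_zero_iff.1 (hC (mem_range_self x))⟩
  -- the least modulus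
  set S : ℝ → Set ℝ := fun δ => (fun p : ℝ × ℝ => ‖f p.1 - f p.2‖) '' {p | |p.1 - p.2| ≤ |δ|}
    with hS
  have hSne : ∀ δ, (S δ).Nonempty := fun δ => ⟨_, ⟨(0, 0), by simp, rfl⟩⟩
  have hSbdd : ∀ δ, BddAbove (S δ) := fun δ => by
    refine ⟨C + C, ?_⟩
    rintro _ ⟨p, -, rfl⟩
    exact (norm_sub_le _ _).trans (add_le_add (hC _) (hC _))
  refine ⟨fun δ => sSup (S δ), ?_, fun δ => ?_, fun t s => ?_⟩
  · rw [Metric.tendsto_nhds_nhds]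
    intro ε hε
    obtain ⟨δ, hδ, hδf⟩ := AubinLions.exists_forall_norm_sub_lt_of_periodic hT hf hper
      (half_pos hε)
    refine ⟨δ, hδ, fun τ hτ => ?_⟩
    rw [Real.dist_eq, sub_zero] at hτ ⊢
    have hle : sSup (S τ) ≤ ε / 2 := by
      refine csSup_le (hSne τ) ?_
      rintro _ ⟨p, hp, rfl⟩
      exact (hδf p.1 p.2 (lt_of_le_of_lt hp hτ)).le
    have hge : 0 ≤ sSup (S τ) := le_csSup_of_le (hSbdd τ) ⟨(0, 0), by simp, rfl⟩ (by simp)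
    rw [abs_of_nonneg hge]
    linarith
  · exact le_csSup_of_le (hSbdd δ) ⟨(0, 0), by simp, rfl⟩ (by simp)
  · exact le_csSup (hSbdd (t - s)) ⟨(t, s), by simp, rfl⟩

/-- **A common modulus for finitely many continuous periodic functions.** [folklore] -/
theorem AubinLions.exists_modulus_finset {ι : Type*} (I : Finset ι) {f : ι → ℝ → F} {T : ℝ}
    (hT : 0 < T) (hf : ∀ i ∈ I, Continuous (f i)) (hper : ∀ i ∈ I, Function.Periodic (f i) T) :
    ∃ ω : ℝ → ℝ, Tendsto ω (𝓝 0) (𝓝 0) ∧ (∀ δ, 0 ≤ ω δ) ∧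
      ∀ i ∈ I, ∀ t s, ‖f i t - f i s‖ ≤ ω (t - s) := by
  classical
  induction I using Finset.induction_on with
  | empty => exact ⟨fun _ => 0, tendsto_const_nhds, fun _ => le_rfl, fun i hi => absurd hi (by simp)⟩
  | insert j I hj ih =>
    obtain ⟨ω₁, hω₁, hω₁0, hω₁b⟩ := ih (fun i hi => hf i (Finset.mem_insert_of_mem hi))
      (fun i hi => hper i (Finset.mem_insert_of_mem hi))
    obtain ⟨ω₂, hω₂, hω₂0, hω₂b⟩ := AubinLions.exists_modulus_of_continuous_periodic hT
      (hf j (Finset.mem_insert_self j I)) (hper j (Finset.mem_insert_self j I))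
    refine ⟨fun δ => ω₁ δ + ω₂ δ, by simpa using hω₁.add hω₂, fun δ => add_nonneg (hω₁0 δ) (hω₂0 δ),
      fun i hi t s => ?_⟩
    rcases Finset.mem_insert.1 hi with rfl | hi'
    · exact (hω₂b t s).trans (le_add_of_nonneg_left (hω₁0 _))
    · exact (hω₁b i hi' t s).trans (le_add_of_nonneg_right (hω₂0 _))

/-- **The infimum of a sequence of approximate moduli is a modulus.** If `ε_n ≥ 0`, `ε_n → 0`,
and `ω_n ≥ 0` with `ω_n(δ) → 0` as `δ → 0` for every `n`, then `Ω(δ) = inf_n (ε_n + ω_n(δ))`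
satisfies `Ω ≥ 0`, `Ω(δ) → 0`, and `Ω ≤ ε_n + ω_n` for every `n`; so any quantity bounded by
`ε_n + ω_n(t − s)` for all `n` is bounded by the single modulus `Ω(t − s)` (the "`ε/3`"
bookkeeping of the Galerkin compactness argument). [folklore] -/
theorem AubinLions.tendsto_iInf_add_modulus {ε : ℕ → ℝ} {ω : ℕ → ℝ → ℝ} (hε0 : ∀ n, 0 ≤ ε n)
    (hε : Tendsto ε atTop (𝓝 0)) (hω0 : ∀ n δ, 0 ≤ ω n δ)
    (hω : ∀ n, Tendsto (ω n) (𝓝 0) (𝓝 0)) :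
    Tendsto (fun δ => ⨅ n, (ε n + ω n δ)) (𝓝 0) (𝓝 0) ∧ (∀ δ, 0 ≤ ⨅ n, (ε n + ω n δ)) ∧
      ∀ n δ, (⨅ m, (ε m + ω m δ)) ≤ ε n + ω n δ := by
  have hbdd : ∀ δ, BddBelow (range fun n => ε n + ω n δ) := fun δ =>
    ⟨0, by rintro _ ⟨n, rfl⟩; exact add_nonneg (hε0 n) (hω0 n δ)⟩
  have hle : ∀ n δ, (⨅ m, (ε m + ω m δ)) ≤ ε n + ω n δ := fun n δ => ciInf_le (hbdd δ) n
  have hge : ∀ δ, 0 ≤ ⨅ n, (ε n + ω n δ) := fun δ =>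
    le_ciInf fun n => add_nonneg (hε0 n) (hω0 n δ)
  refine ⟨?_, hge, hle⟩
  rw [Metric.tendsto_nhds_nhds]
  intro η hη
  -- `ε n < η/2` for some `n`
  have h1 : ∀ᶠ n in atTop, dist (ε n) 0 < η / 2 := Metric.tendsto_nhds.1 hε (η / 2) (half_pos hη)
  obtain ⟨n, hn⟩ := h1.exists
  rw [Real.dist_eq, sub_zero, abs_of_nonneg (hε0 n)] at hn
  -- `ω n δ < η/2` near `0`
  obtain ⟨ρ, hρ, hρω⟩ := Metric.tendsto_nhds_nhds.1 (hω n) (η / 2) (half_pos hη)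
  refine ⟨ρ, hρ, fun δ hδ => ?_⟩
  have h2 := hρω hδ
  rw [Real.dist_eq, sub_zero, abs_of_nonneg (hω0 n δ)] at h2
  rw [Real.dist_eq, sub_zero, abs_of_nonneg (hge δ)]
  calc (⨅ m, (ε m + ω m δ)) ≤ ε n + ω n δ := hle n δ
    _ < η / 2 + η / 2 := add_lt_add hn h2
    _ = η := by ring

end Literature.Analysis.FunctionSpaces

end
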